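import Summits.BirchSwinnertonDyer.BirchSwinnertonDyer.Theorems.EisensteinPrimesBSDpOnCellCTelescopeBranchLatticeRestrict
import Summits.BirchSwinnertonDyer.BirchSwinnertonDyer.Theorems.EisensteinPrimesBSDpOnCellCTelescopeBranchMemberIsogenyOfConj
import Summits.BirchSwinnertonDyer.BirchSwinnertonDyer.Theorems.EisensteinPrimesBSDpOnCellCTelescopeBranchCurveIsogenyOfConj
import Summits.BirchSwinnertonDyer.BirchSwinnertonDyer.Theorems.EisensteinPrimesBSDpOnCellCTelescopeBranchTateAdapter
import Summits.BirchSwinnertonDyer.BirchSwinnertonDyer.Theorems.EisensteinPrimesBSDpOnCellCTelescopeBranchPiTopologyOpenIdeals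
import Literature.NumberTheory.EllipticCurves.PNewBranchGaloisLattice
import HarnessLib

/-!
# [telescope — width x2-p2 g23, 2026-08-30] THE KEYSTONE OF THE N1 BRIDGE: `IsBranchGaloisLattice W p x D ρ` (the Galois clause of the
# Literature fact T-An-2ᵍ `hida1986_castella2020_exists_galoisLattice_on_pNewBranchChart`) ⟹ leaf N1's REGISTERED CONCLUSION
# (v13c/v14 `stub_branchLattice` conclusion l.440–473, token for token) for the road objects `W p N K κ 𝔭bar x D` (`‖x k‖ < 1`, `W.conductorNorm ℤ = N ≠ 0`)
# Crux 4 `BSDpOnCellC` (stmt-BirchSwinnertonDyer-19034), line «telescope», lattice slot of v15/v16/v17 (`--supports`, helper; closes nothing REGISTERED)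

WHY: assembles the whole Galois-side chain built today by this seat and the ideator lane, BY NAME, with NO further input:
(G-unr) → #7 `TelescopeBranchLatticeRestrict.exists_S0_of_isUnramifiedAt_rat`; (G-fib₀) → ideator g42's ADAPTER-T
`TelescopeBranchTateAdapter.exists_tateAdapter` + #10 `TelescopeBranchCurveIsogenyOfConj.exists_fd0_isogeny_of_conj_of_adapter` (inside: g41 H2 + #4);
(G-fib_t) ∧ (G-rat) → #9 `TelescopeBranchMemberIsogenyOfConj.exists_member_isogeny_of_conj` (inside: g41 H3 + #4 + #8); topology = the product
topology `PowerSeries.WithPiTopology` (the one `IsBranchGaloisLattice` is typed with), `(C p^k, X^m)` open by g41 H1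
`TelescopeBranchPiTopologyOpenIdeals.hΛ_piTopology`; then #7 `branchLattice_conclusion_of_framed_rat` (restriction Γ_ℚ → Γ_K + #5 + #3's witness
`A₂ = (Λ^*)²`). USE (successor LEAD, v17 per ideator g42's PREFIX-G recipe): with `∃ ρ, IsBranchGaloisLattice W p x D ρ` riding in the road package,
the lattice leaf closes by `obtain ⟨ρ, hG⟩ := …; exact branchLattice_conclusion_of_isBranchGaloisLattice … ρ hG`.

CONTENT (namespace `…Theorems.TelescopeBranchLatticeOfGaloisLattice`; THEOREMS ONLY): **`branchLattice_conclusion_of_isBranchGaloisLattice`**.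

HONEST FRAMING: composition only; the Literature fact T-An-2ᵍ is NOT proved (it is a cited named fact, review/typer lane); the prefix-side (wt)/(rat)/(G)
threading is the LEAD's v16/v17; closes no registered stub, no crux, no summit statement; BSD is proved for no curve by this file. No named fact, no
definition, no instance, no `sorry`.
References (shape only): [cite: Hida1986, Thm. 2.1 (2.2b) (2.2c)] [cite: Wiles1988, §2] [cite: Greenberg2006, p. 342 L4–11]
-/

set_option autoImplicit false
set_option linter.dupNamespace false

noncomputable section

open scoped Classical MatrixGroups PowerSeries.WithPiTopology
open NumberField IsDedekindDomain Field PowerSeries Finset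
  Literature.NumberTheory.EllipticCurves Literature.NumberTheory.EllipticCurves.GreenbergSelmer
  Literature.NumberTheory.GaloisRepresentations Literature.NumberTheory.IwasawaTheory
  Literature.NumberTheory.EllipticCurves.BigGaloisRep
  Summit.BirchSwinnertonDyer.BirchSwinnertonDyer.Theorems

namespace Summit.BirchSwinnertonDyer.BirchSwinnertonDyer.Theorems.TelescopeBranchLatticeOfGaloisLattice

set_option maxHeartbeats 1600000 in
set_option synthInstance.maxHeartbeats 80000 in
/-- **`IsBranchGaloisLattice W p x D ρ` ⟹ the conclusion of leaf N1 (`stub_branchLattice`, v13c/v14 text l.440–473, token for token)** for the road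
objects `W p N K κ 𝔭bar x D` with `‖x k‖ < 1` and `W.conductorNorm ℤ = N ≠ 0`, the framed `ρ : Γ_ℚ →ₜ* GL₂(ℤ_p⟦X⟧)` being continuous for the
product topology (as in the Literature predicate). Witness: `A₂ = Fin 2 → BigRepModule ℤ_[p] p (QpModZp p)` with the cofree realisation of
`ρ|_{Γ_K}`. [cite: Hida1986, Thm. 2.1 (2.2b) (2.2c)] [cite: Greenberg2006, p. 342 L4–11] -/
theorem branchLattice_conclusion_of_isBranchGaloisLattice
    (W : WeierstrassCurve ℚ) [W.IsElliptic] [W.IsGloballyMinimal] (p : ℕ) [Fact p.Prime]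
    (N : ℕ) [NeZero N] (hN : W.conductorNorm ℤ = N) (K : Type) [Field K] [NumberField K] (κ : ZpExtension K p)
    (𝔭bar : HeightOneSpectrum (𝓞 K)) (x : ℕ → ℤ_[p]) (D : ℕ → Skinner2016.HidaCongruentForm W p 1) (hx : ∀ k, ‖x k‖ < 1)
    (ρ : FramedGaloisRep ℚ (PowerSeries ℤ_[p]) 2) (hG : IsBranchGaloisLattice W p x D ρ) :
    ∃ (_ : TopologicalSpace (PowerSeries ℤ_[p])) (A₂ : Type) (_ : AddCommGroup A₂)
        (_ : Module (PowerSeries ℤ_[p]) A₂) (_ : TopologicalSpace A₂) (_ : DiscreteTopology A₂)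
        (ρ₂ : ContinuousRep (Field.absoluteGaloisGroup K) (PowerSeries ℤ_[p]) A₂)
        (_ : TopologicalSpace (PowerSeries (PowerSeries ℤ_[p]))) (_ : IsTopologicalRing (PowerSeries (PowerSeries ℤ_[p])))
        (_ : ContinuousSMul (PowerSeries (PowerSeries ℤ_[p])) (BigRepModule (PowerSeries ℤ_[p]) p A₂))
        (_ : Module (PowerSeries ℤ_[p]) (XBig κ ρ₂ 𝔭bar (∅ : Set (HeightOneSpectrum (𝓞 K)))))
        (_ : IsScalarTower (PowerSeries ℤ_[p]) (PowerSeries (PowerSeries ℤ_[p]))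
          (XBig κ ρ₂ 𝔭bar (∅ : Set (HeightOneSpectrum (𝓞 K))))),
        (Literature.NumberTheory.IwasawaTheory.Greenberg2016.IsCofree (PowerSeries ℤ_[p]) A₂ ∧
          (∀ a : A₂, ∃ n : ℕ, (PowerSeries.X : PowerSeries ℤ_[p]) ^ n • a = 0) ∧
          (∀ a : A₂, ∃ b : A₂, (PowerSeries.X : PowerSeries ℤ_[p]) • b = a) ∧
          (∀ (k : ℕ) (a : A₂), ∃ b : A₂, (PowerSeries.X - PowerSeries.C (x k)) • b = a) ∧
          (∃ S₀ : Set (HeightOneSpectrum (𝓞 K)), S₀.Finite ∧ GaloisRep.IsUnramifiedOutside S₀ ρ₂ ∧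
            ∀ w ∈ S₀, ((p : ℕ) : 𝓞 K) ∉ w.asIdeal → ((N : ℕ) : 𝓞 K) ∈ w.asIdeal) ∧
          (∃ θ₀ : Submodule.torsionBy (PowerSeries ℤ_[p]) A₂ (PowerSeries.X : PowerSeries ℤ_[p]) →+
              PrimaryTorsion (W.baseChange K).geomPoints p,
            (∀ (c : ℤ_[p]) (a : Submodule.torsionBy (PowerSeries ℤ_[p]) A₂ (PowerSeries.X : PowerSeries ℤ_[p])),
                θ₀ (PowerSeries.C c • a) = c • θ₀ a) ∧
            (∀ (σ : Field.absoluteGaloisGroup K)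
                (a : Submodule.torsionBy (PowerSeries ℤ_[p]) A₂ (PowerSeries.X : PowerSeries ℤ_[p])),
                θ₀ (BigGaloisRep.torsionRep ρ₂ (PowerSeries.X : PowerSeries ℤ_[p]) σ a) =
                  (W.baseChange K).primaryTorsionGaloisRep p σ (θ₀ a)) ∧
            Finite θ₀.ker ∧ Finite (PrimaryTorsion (W.baseChange K).geomPoints p ⧸ θ₀.range)) ∧
          (∀ k : ℕ, Function.Surjective (algebraMap ℤ_[p] (padicCoeffIntegers (D k).ι)) ∧
            ∃ θ : Submodule.torsionBy (PowerSeries ℤ_[p]) A₂ (PowerSeries.X - PowerSeries.C (x k)) →+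
                Cofree (D k).Δ.selfDualRep (padicCoeffField (D k).ι),
              (∀ (c : ℤ_[p])
                  (a : Submodule.torsionBy (PowerSeries ℤ_[p]) A₂ (PowerSeries.X - PowerSeries.C (x k))),
                  θ (PowerSeries.C c • a) = algebraMap ℤ_[p] (padicCoeffIntegers (D k).ι) c • θ a) ∧
              (∀ (σ : Field.absoluteGaloisGroup K)
                  (a : Submodule.torsionBy (PowerSeries ℤ_[p]) A₂ (PowerSeries.X - PowerSeries.C (x k))),
                  θ (BigGaloisRep.torsionRep ρ₂ (PowerSeries.X - PowerSeries.C (x k)) σ a) =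
                    (D k).Δ.selfDualCofreeRepOver K σ (θ a)) ∧
              Finite θ.ker ∧ Finite (Cofree (D k).Δ.selfDualRep (padicCoeffField (D k).ι) ⧸ θ.range))) := by
  obtain ⟨hunr, ⟨b, P, hfib0⟩, hfibt, hrat⟩ := hG
  have hN0 : N ≠ 0 := NeZero.ne N
  -- (G-unr) with `N` for `W.conductorNorm ℤ`
  have hunr' : ∀ v : HeightOneSpectrum (𝓞 ℚ), ¬ ((Rat.HeightOneSpectrum.primesEquiv v : Nat.Primes) : ℕ) ∣ N → ρ.IsUnramifiedAt v := by
    intro v hv; exact hunr v (hN ▸ hv)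
  -- (G-fib₀): ADAPTER-T + #10
  obtain ⟨t, -, htlin, htinj, htsurj, hteq⟩ := TelescopeBranchTateAdapter.exists_tateAdapter W p b
  have hfd₀ := TelescopeBranchCurveIsogenyOfConj.exists_fd0_isogeny_of_conj_of_adapter W ρ b P hfib0 t htlin htinj htsurj hteq
  -- (G-fib_t) ∧ (G-rat): #9, member by member
  have hfd : ∀ k : ℕ, Function.Surjective (algebraMap ℤ_[p] (padicCoeffIntegers (D k).ι)) ∧
      ∃ (M : Field.absoluteGaloisGroup ℚ → Matrix (Fin 2) (Fin 2) ℤ_[p])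
        (U : Field.absoluteGaloisGroup ℚ → Matrix (Fin 2) (Fin 2) (PowerSeries ℤ_[p])),
        (∀ σ : Field.absoluteGaloisGroup ℚ, ((ρ σ : GL (Fin 2) (PowerSeries ℤ_[p])) : Matrix (Fin 2) (Fin 2) (PowerSeries ℤ_[p])) =
          (M σ).map (PowerSeries.C (R := ℤ_[p])) + (PowerSeries.X - PowerSeries.C (x k) : PowerSeries ℤ_[p]) • U σ) ∧
      ∃ e : (Fin 2 → QpModZp p) →+ Cofree (D k).Δ.selfDualRep (padicCoeffField (D k).ι),
        (∀ (c : ℤ_[p]) (v : Fin 2 → QpModZp p), e (c • v) = algebraMap ℤ_[p] (padicCoeffIntegers (D k).ι) c • e v) ∧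
        (∀ (σ : Field.absoluteGaloisGroup ℚ) (v : Fin 2 → QpModZp p),
          e (fun i ↦ ∑ j, M σ i j • v j) = (D k).Δ.selfDualCofreeRep σ (e v)) ∧
        Finite e.ker ∧ Finite (Cofree (D k).Δ.selfDualRep (padicCoeffField (D k).ι) ⧸ e.range) := by
    intro k
    obtain ⟨M, U, P', hMU⟩ := hfibt k
    obtain ⟨e, helin, heeq, heker, hecoker⟩ :=
      TelescopeBranchMemberIsogenyOfConj.exists_member_isogeny_of_conj (D k).Δ (hrat k) M P' (fun σ ↦ (hMU σ).2)
    exact ⟨hrat k, M, U, fun σ ↦ (hMU σ).1, e, helin, heeq, heker, hecoker⟩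
  exact TelescopeBranchLatticeRestrict.branchLattice_conclusion_of_framed_rat W p N hN0 K κ 𝔭bar x D hx inferInstance inferInstance
    TelescopeBranchPiTopologyOpenIdeals.hΛ_piTopology ρ hunr' hfd₀ hfd

end Summit.BirchSwinnertonDyer.BirchSwinnertonDyer.Theorems.TelescopeBranchLatticeOfGaloisLattice

end
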